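/-
Copyright (c) 2026 the pub-hodgecm-mathlib formalisation cell (harness21).  Prover seat hodgecm-mathlib-K2E5-p16 (g4): Track B «K2-LIT»,
hLiu418 = stmt-HodgeConjecture-24832, LEAD F0P6-plan (g11) LAST DEALS 2026-09-04T05:45:00Z (1) «Φ6b-1 `K2LiuHermTwoConfluentXiDefs`» (in force
under LEAD (g12)) = ROAD Φ organ Φ6b-1, DEFS leaf: Shimura's confluent hypergeometric function `ξ(g, h; α, β)` on `Herm₂(ℂ)`; 2026-09-04.
-/
import Summits.HodgeConjecture.HodgeConjecture.Theorems.K2LiuHermTwoGammaDefs              -- ★ p857639: `hermTwo`, `hermTwoGamma` + API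
import Mathlib.Analysis.SpecialFunctions.Pow.Continuity
import Mathlib.MeasureTheory.Function.SpecialFunctions.Basic
import Mathlib.MeasureTheory.Constructions.BorelSpace.Complex
import HarnessLib

/-!
# Crux `HLiu418`, ROAD Φ, organ Φ6b-1 — DEFS leaf: Shimura's confluent hypergeometric function `ξ(g, h; α, β)` on `Herm₂(ℂ)`

Cell `hodgecm-mathlib`, crux item hLiu418 = `stmt-HodgeConjecture-24832`, route of record `HCCMUnconditional`; squad K2, LEAD F0P6-plan (g11 → g12)
(LAST DEALS 05:45:00Z (1): «Φ6b-1 `Theorems/K2LiuHermTwoConfluentXiDefs.lean` + `…XiConvergence.lean` (Fourier-side definition of Shimura's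
`ξ(y, h; α, β)` on `Herm₂(ℂ)` with absolute convergence)»), dealer K2E5-plan (g5) (CENSUS-41 row Φ6), prover K2E5-p16 (g4).  DEFINITIONS WITH
BODIES + `rfl`∕algebraic API (no instance, no notation, no named-fact hypothesis, no `sorry`, default heartbeats); Mathlib + ★ DEFS leaf `hermTwo`;
lane `--supports stmt-HodgeConjecture-24832 --as helper` (count-neutral; definitions ⇒ review lane).

THE OBJECT [Shimura1982, (1.25), Case II (Hermitian matrices), m = κ = 2].  For `g ∈ Ω = Herm₂(ℂ)⁺`, `h ∈ V = Herm₂(ℂ)`, `(α, β) ∈ ℂ²`: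
  `ξ(g, h; α, β) = ∫_V e(−τ(hx)) · det(x + ig)^{−α} · det(x − ig)^{−β} dx`,  `e(t) = exp(2πi t)`, `τ` = trace,
`dx` = Lebesgue measure of the chart `x = hermTwo (a, z, b)` (★ Φ6a; `da·d(re z)·d(im z)·db`).
THE BRANCH (documented convention, m = 2).  `x + ig = i·(g − ix)` and `x − ig = −i·(g + ix)` with `g ∓ ix` in the right half-space `𝔓 = Ω + iV`, on
which `det` omits `(−∞, 0]` (★ Φ6b-0 `det_cpow_eq_of_tube`; here `(g ∓ ix) + (g ∓ ix)ᴴ = 2g > 0`), so the principal powers `det(g ∓ ix)^{−s}` are the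
continuous branches there; the continuous branch of `log det` on the tube `V + iΩ` with `log det(ig) = log det g + iπ` (`det(iy)^s = i^{ms} det(y)^s`)
gives  `det(x + ig)^{−α} := e^{−iπα} · det(g − ix)^{−α}`  and  `det(x − ig)^{−β} := e^{iπβ} · det(g + ix)^{−β}`  (principal powers on the right).
Should the print fix the opposite normalisation, the difference is the explicit constant `e^{iπ(β−α)}` (one lemma: `xiTwoIntegrand_eq`).

CONTENTS.  `xiTwoIntegrand g h α β : ℝ × ℂ × ℝ → ℂ` (the integrand in the chart), `xiTwo g h α β : ℂ := ∫ c, xiTwoIntegrand g h α β c`;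
API: `xiTwoIntegrand_apply`, `xiTwo_def`, `det_add_I_smul_hermTwo` ∕ `det_sub_I_smul_hermTwo` (entrywise formulas), `trace_mul_hermTwo`,
`continuous_det_add_I_smul_hermTwo`, `measurable_xiTwoIntegrand` ∕ `aestronglyMeasurable_xiTwoIntegrand`.
NOT here: absolute convergence for `re(α+β) > 2κ − 1 = 3` (★-to-be `K2LiuHermTwoConfluentXiConvergence`, via ★ `integrable_norm_det_add_I_smul_rpow_neg`),
Shimura's `η`, `ω`, `ζ` functions and the analytic continuation (Φ6b-2…, print-gated acq-15212), estimates.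
HONEST LABEL.  Count-neutral DEFS leaf; it pays nothing by itself: `HC_CM` is proved only modulo the 7 printed citations (2 remaining named inputs:
hLiu418 = `stmt-HodgeConjecture-24832`, h413 = `stmt-HodgeConjecture-24833`) until rung 0 closes.

## References (orientation only)
* [Shimura1982] G. Shimura, *Confluent hypergeometric functions on tube domains*, Math. Ann. 260 (1982) 269–302: §1 (1.25)–(1.29), §3 Thm. 3.1.
-/

set_option autoImplicit false
-- the mandated namespace repeats the single-problem summit's segment (`HodgeConjecture.HodgeConjecture`)
set_option linter.dupNamespace false

noncomputable section

open Complex MeasureTheory Set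
open scoped ComplexOrder ComplexConjugate

namespace Summit.HodgeConjecture.HodgeConjecture.Cruxes.HLiu418.K2LiuHermTwoConfluentXiDefs

open Summit.HodgeConjecture.HodgeConjecture.Cruxes.HLiu418.K2LiuHermTwoGammaDefs

/-! ## The integrand and the function -/

/-- THE INTEGRAND OF SHIMURA'S `ξ` on `Herm₂(ℂ)` in the chart `x = hermTwo c` [Shimura1982, (1.25), Case II, m = 2]:
`e(−τ(h x)) · det(x + ig)^{−α} · det(x − ig)^{−β}` with `e(t) = exp(2πi t)` and the branches
`det(x + ig)^{−α} := e^{−iπα} det(g − ix)^{−α}`, `det(x − ig)^{−β} := e^{iπβ} det(g + ix)^{−β}` (principal powers; see the module docstring). -/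
def xiTwoIntegrand (g h : Matrix (Fin 2) (Fin 2) ℂ) (α β : ℂ) (c : ℝ × ℂ × ℝ) : ℂ :=
  cexp (-(2 * Real.pi * I) * (h * hermTwo c).trace) *
    ((cexp (-(Real.pi * I) * α) * (g - I • hermTwo c).det ^ (-α)) *
      (cexp ((Real.pi * I) * β) * (g + I • hermTwo c).det ^ (-β)))

/-- SHIMURA'S CONFLUENT HYPERGEOMETRIC FUNCTION `ξ(g, h; α, β)` OF THE TUBE OVER `Herm₂(ℂ)` [Shimura1982, (1.25), Case II, m = 2]:
`ξ(g, h; α, β) = ∫_{Herm₂(ℂ)} e(−τ(hx)) det(x + ig)^{−α} det(x − ig)^{−β} dx` (Bochner integral over the chart `ℝ × ℂ × ℝ`; it is the genuine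
absolutely convergent integral for `g > 0`, `h` Hermitian and `re(α + β) > 3`, ★-to-be `K2LiuHermTwoConfluentXiConvergence`, and `0` by the Bochner
convention where the integrand is not integrable). -/
def xiTwo (g h : Matrix (Fin 2) (Fin 2) ℂ) (α β : ℂ) : ℂ :=
  ∫ c : ℝ × ℂ × ℝ, xiTwoIntegrand g h α β c

/-- Unfolding lemma for the integrand. -/
theorem xiTwoIntegrand_apply (g h : Matrix (Fin 2) (Fin 2) ℂ) (α β : ℂ) (c : ℝ × ℂ × ℝ) :
    xiTwoIntegrand g h α β c =
      cexp (-(2 * Real.pi * I) * (h * hermTwo c).trace) *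
        ((cexp (-(Real.pi * I) * α) * (g - I • hermTwo c).det ^ (-α)) *
          (cexp ((Real.pi * I) * β) * (g + I • hermTwo c).det ^ (-β))) := rfl

/-- Unfolding lemma for `ξ`. -/
theorem xiTwo_def (g h : Matrix (Fin 2) (Fin 2) ℂ) (α β : ℂ) :
    xiTwo g h α β = ∫ c : ℝ × ℂ × ℝ, xiTwoIntegrand g h α β c := rfl

/-- The integrand with the branch constants collected: `e^{iπ(β − α)} · e(−τ(hx)) · det(g − ix)^{−α} · det(g + ix)^{−β}`. -/
theorem xiTwoIntegrand_eq (g h : Matrix (Fin 2) (Fin 2) ℂ) (α β : ℂ) (c : ℝ × ℂ × ℝ) :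
    xiTwoIntegrand g h α β c =
      cexp ((Real.pi * I) * (β - α)) * (cexp (-(2 * Real.pi * I) * (h * hermTwo c).trace) *
        ((g - I • hermTwo c).det ^ (-α) * (g + I • hermTwo c).det ^ (-β))) := by
  rw [xiTwoIntegrand_apply, show (Real.pi * I) * (β - α) = -(Real.pi * I) * α + (Real.pi * I) * β by ring, Complex.exp_add]
  ring

/-! ## Entrywise formulas and measurability -/

/-- `det(g + ix)` entrywise: `(g₀₀ + ia)(g₁₁ + ib) − (g₀₁ + iz)(g₁₀ + i z̄)`. -/
theorem det_add_I_smul_hermTwo (g : Matrix (Fin 2) (Fin 2) ℂ) (c : ℝ × ℂ × ℝ) :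
    (g + I • hermTwo c).det =
      (g 0 0 + I * (c.1 : ℂ)) * (g 1 1 + I * (c.2.2 : ℂ)) - (g 0 1 + I * c.2.1) * (g 1 0 + I * conj c.2.1) := by
  rw [Matrix.det_fin_two]
  simp only [Matrix.add_apply, Matrix.smul_apply, smul_eq_mul, hermTwo_apply_zero_zero, hermTwo_apply_zero_one,
    hermTwo_apply_one_zero, hermTwo_apply_one_one]

/-- `det(g − ix)` entrywise: `(g₀₀ − ia)(g₁₁ − ib) − (g₀₁ − iz)(g₁₀ − i z̄)`. -/
theorem det_sub_I_smul_hermTwo (g : Matrix (Fin 2) (Fin 2) ℂ) (c : ℝ × ℂ × ℝ) :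
    (g - I • hermTwo c).det =
      (g 0 0 - I * (c.1 : ℂ)) * (g 1 1 - I * (c.2.2 : ℂ)) - (g 0 1 - I * c.2.1) * (g 1 0 - I * conj c.2.1) := by
  rw [Matrix.det_fin_two]
  simp only [Matrix.sub_apply, Matrix.smul_apply, smul_eq_mul, hermTwo_apply_zero_zero, hermTwo_apply_zero_one,
    hermTwo_apply_one_zero, hermTwo_apply_one_one]

/-- `τ(h x)` entrywise: `tr(h · hermTwo (a, z, b)) = h₀₀ a + h₀₁ z̄ + h₁₀ z + h₁₁ b`. -/
theorem trace_mul_hermTwo (h : Matrix (Fin 2) (Fin 2) ℂ) (c : ℝ × ℂ × ℝ) :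
    (h * hermTwo c).trace = h 0 0 * (c.1 : ℂ) + h 0 1 * conj c.2.1 + h 1 0 * c.2.1 + h 1 1 * (c.2.2 : ℂ) := by
  rw [Matrix.trace_fin_two, Matrix.mul_apply, Matrix.mul_apply, Fin.sum_univ_two, Fin.sum_univ_two]
  simp only [hermTwo_apply_zero_zero, hermTwo_apply_zero_one, hermTwo_apply_one_zero, hermTwo_apply_one_one]
  ring

/-- For HERMITIAN `h`, `τ(h x)` is real: `tr(h · hermTwo (a, z, b)) = re(h₀₀) a + re(h₁₁) b + 2 re(h₁₀ z)`. -/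
theorem trace_mul_hermTwo_of_isHermitian {h : Matrix (Fin 2) (Fin 2) ℂ} (hh : h.IsHermitian) (c : ℝ × ℂ × ℝ) :
    (h * hermTwo c).trace = (((h 0 0).re * c.1 + (h 1 1).re * c.2.2 + 2 * (h 1 0 * c.2.1).re : ℝ) : ℂ) := by
  rw [← hermTwo_eq_of_isHermitian hh, trace_mul_hermTwo]
  simp only [hermTwo_apply_zero_zero, hermTwo_apply_zero_one, hermTwo_apply_one_zero, hermTwo_apply_one_one, ofReal_re]
  apply Complex.ext
  · simp
    ring
  · simp
    ring

/-- `c ↦ det(g + i·hermTwo c)` is continuous. -/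
theorem continuous_det_add_I_smul_hermTwo (g : Matrix (Fin 2) (Fin 2) ℂ) :
    Continuous fun c : ℝ × ℂ × ℝ => (g + I • hermTwo c).det := by
  have h : (fun c : ℝ × ℂ × ℝ => (g + I • hermTwo c).det) = fun c =>
      (g 0 0 + I * (c.1 : ℂ)) * (g 1 1 + I * (c.2.2 : ℂ)) - (g 0 1 + I * c.2.1) * (g 1 0 + I * conj c.2.1) :=
    funext (det_add_I_smul_hermTwo g)
  rw [h]
  fun_prop

/-- `c ↦ det(g − i·hermTwo c)` is continuous. -/
theorem continuous_det_sub_I_smul_hermTwo (g : Matrix (Fin 2) (Fin 2) ℂ) :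
    Continuous fun c : ℝ × ℂ × ℝ => (g - I • hermTwo c).det := by
  have h : (fun c : ℝ × ℂ × ℝ => (g - I • hermTwo c).det) = fun c =>
      (g 0 0 - I * (c.1 : ℂ)) * (g 1 1 - I * (c.2.2 : ℂ)) - (g 0 1 - I * c.2.1) * (g 1 0 - I * conj c.2.1) :=
    funext (det_sub_I_smul_hermTwo g)
  rw [h]
  fun_prop

/-- `c ↦ tr(h · hermTwo c)` is continuous. -/
theorem continuous_trace_mul_hermTwo (h : Matrix (Fin 2) (Fin 2) ℂ) :
    Continuous fun c : ℝ × ℂ × ℝ => (h * hermTwo c).trace := by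
  have h' : (fun c : ℝ × ℂ × ℝ => (h * hermTwo c).trace) = fun c =>
      h 0 0 * (c.1 : ℂ) + h 0 1 * conj c.2.1 + h 1 0 * c.2.1 + h 1 1 * (c.2.2 : ℂ) := funext (trace_mul_hermTwo h)
  rw [h']
  fun_prop

/-- The `ξ`-integrand is measurable on `ℝ × ℂ × ℝ`. -/
theorem measurable_xiTwoIntegrand (g h : Matrix (Fin 2) (Fin 2) ℂ) (α β : ℂ) :
    Measurable (xiTwoIntegrand g h α β) := by
  unfold xiTwoIntegrand
  refine Measurable.mul ?_ (Measurable.mul ?_ ?_)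
  · exact Complex.measurable_exp.comp (measurable_const.mul (continuous_trace_mul_hermTwo h).measurable)
  · exact measurable_const.mul ((continuous_det_sub_I_smul_hermTwo g).measurable.pow_const _)
  · exact measurable_const.mul ((continuous_det_add_I_smul_hermTwo g).measurable.pow_const _)

/-- The `ξ`-integrand is a.e.-strongly measurable (so that `Integrable` reduces to a bound on its norm). -/
theorem aestronglyMeasurable_xiTwoIntegrand (g h : Matrix (Fin 2) (Fin 2) ℂ) (α β : ℂ) :
    AEStronglyMeasurable (xiTwoIntegrand g h α β) (volume : Measure (ℝ × ℂ × ℝ)) :=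
  (measurable_xiTwoIntegrand g h α β).aestronglyMeasurable

end Summit.HodgeConjecture.HodgeConjecture.Cruxes.HLiu418.K2LiuHermTwoConfluentXiDefs

end
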